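import Summits.ResolutionOfSingularities.ResolutionOfSingularities.Theorems.FrobeniusLadderFInjectiveMacaulayficationFiniteGradedDescent
import Summits.ResolutionOfSingularities.ResolutionOfSingularities.Theorems.FrobeniusLadderFInjectiveMacaulayficationGradeZeroRetractQuotient
import Summits.ResolutionOfSingularities.ResolutionOfSingularities.Theorems.FrobeniusLadderFInjectiveMacaulayficationIntegralSubalgebraLocalDim
import Summits.ResolutionOfSingularities.ResolutionOfSingularities.Theorems.FrobeniusLadderFInjectiveMacaulayficationSubalgebraIntegralOfPow
import Summits.ResolutionOfSingularities.ResolutionOfSingularities.Theorems.FrobeniusLadderFInjectiveMacaulayficationHypersurfaceLocalDim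
import Summits.ResolutionOfSingularities.ResolutionOfSingularities.Theorems.FrobeniusLadderFInjectiveMacaulayficationWeightedSubstitution
import Mathlib.RingTheory.MvPolynomial.WeightedHomogeneous
import Mathlib.RingTheory.Ideal.Quotient.Operations
import Mathlib.Algebra.CharP.Algebra
import Mathlib.Data.ZMod.Basic
import HarnessLib

/-!
# Weight-zero descent of the clause on a graded hypersurface ring (crux `FInjectiveMacaulayfication`, line `Sketch`)

Support file for crux stmt-ResolutionOfSingularities-15315 (`FrobeniusLadder.FInjectiveMacaulayfication`,
registered skeleton `10f06f91`, line `Sketch`, §15 THE WEIGHTED CONE ENGINE). It assembles the landed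
engine pieces E4 into the Θ-free heart of the registered stub `stub_weightedChartClause` (#22):

Let `k` be a field of characteristic `p`, `e > 0`, `W : Fin n → ℤ/e` weights, `0 ≠ g ∈ k[X₀,…,X_{n-1}]`
weighted homogeneous (of any weight `δ`), `B = k[X]/(g)`, and `A ⊆ B` the `k`-subalgebra of classes of
weight-`0̄` polynomials (the ring of invariants of the `μ_e`-action; in the engine `e = w_v`, `W = e_v - w`,
and `A` is the affine chart ring of the weighted blow-up). Then for every `b ∈ B` and `N` with `b ^ N ∈ A`:
if the local rings `B_Q` at the maximal ideals `Q ∋ b` satisfy the crux's per-stalk clause (every system of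
parameters weakly regular and generating a Frobenius closed ideal), so do the local rings `A_𝔫` at the
maximal ideals `𝔫 ∋ b ^ N`.

* `exists_weightZeroSubalgebra` — the weight-`0̄` classes form a `k`-subalgebra `A` of `k[X]/(g)`
  (existence with the membership characterization used by the registered stubs #8, #21, #22).
* `mk_pow_mem_of_isWeightedHomogeneous_zero` / `mk_X_pow_mem` — `ū ∈ A` for `u` of weight `0̄`; in
  particular `x̄_j ^ e ∈ A` (`e • W j = 0` in `ℤ/e`).
* `weightZero_clause_descent` — the descent statement above.

Proof of the descent: the degree-`0̄` retraction `ρ : B → A` (#8 `GradeZeroRetractQuotient`, fed with the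
component rule of #19 `WeightedSubstitution.weightedHomogeneousComponent_mul_of_isWeightedHomogeneous`);
`B` is integral over `A` (#12 `SubalgebraIntegralOfPow`: `x̄_j ^ e ∈ A` and the `x̄_j` generate `B`); all
local rings of `B` at maximal ideals have dimension `n - 1` (#10 `HypersurfaceLocalDim`), hence so do those
of `A` (#11 `IntegralSubalgebraLocalDim`); conclude by the finite graded descent #9 `FiniteGradedDescent`.
Degenerate cases (`n = 0`, or `g` a unit so that `B = 0`) are vacuous: `A` has no maximal ideal.
No definitions, no named facts; everything is assembly of landed files.

## References

* M. Hochster, J. L. Roberts, *Rings of invariants of reductive groups acting on regular rings are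
  Cohen–Macaulay*, Adv. Math. 13 (1974) — direct summands (through the imported E4 files); folklore.
-/

-- single-problem summit: the doubled namespace component is forced
set_option linter.dupNamespace false

noncomputable section

namespace Summit.ResolutionOfSingularities.ResolutionOfSingularities.Theorems.FInjectiveMacaulayfication.WeightZeroClauseDescent

open MvPolynomial
open Summit.ResolutionOfSingularities.ResolutionOfSingularities.Theorems.FInjectiveMacaulayfication

/-! ## The weight-`0̄` subalgebra of a graded hypersurface ring -/

/-- **The weight-`0̄` subalgebra exists.** For any weights `W : Fin n → M` (`M` an additive commutative
monoid) and any `g ∈ k[X]`, the classes in `k[X]/(g)` of the polynomials that are weighted homogeneous of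
weight `0` form a `k`-subalgebra: the weight-`0` polynomials are a subalgebra of `k[X]` (closed under `+`,
`*`, constants) and we take its image under the quotient map. [folklore] -/
theorem exists_weightZeroSubalgebra (k : Type) [Field k] (n : ℕ) (M : Type) [AddCommMonoid M]
    (W : Fin n → M) (g : MvPolynomial (Fin n) k) :
    ∃ A : Subalgebra k (MvPolynomial (Fin n) k ⧸ Ideal.span {g}),
      ∀ b : MvPolynomial (Fin n) k ⧸ Ideal.span {g}, b ∈ A ↔ ∃ U : MvPolynomial (Fin n) k,
        MvPolynomial.IsWeightedHomogeneous W U 0 ∧ Ideal.Quotient.mk (Ideal.span {g}) U = b := by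
  -- the weight-`0` polynomials, as a subalgebra of `k[X]`
  let A₀ : Subalgebra k (MvPolynomial (Fin n) k) :=
    { carrier := {U | IsWeightedHomogeneous W U 0}
      mul_mem' := fun {U V} hU hV => by
        have h := IsWeightedHomogeneous.mul hU hV
        rwa [add_zero] at h
      one_mem' := isWeightedHomogeneous_one k W
      add_mem' := fun {U V} hU hV => hU.add hV
      zero_mem' := isWeightedHomogeneous_zero k W 0
      algebraMap_mem' := fun c => isWeightedHomogeneous_C W c }
  refine ⟨A₀.map (Ideal.Quotient.mkₐ k (Ideal.span {g})), fun b => ?_⟩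
  rw [Subalgebra.mem_map]
  constructor
  · rintro ⟨U, hU, rfl⟩
    exact ⟨U, hU, rfl⟩
  · rintro ⟨U, hU, rfl⟩
    exact ⟨U, hU, rfl⟩

/-- The class of a weight-`0̄` polynomial lies in the weight-`0̄` subalgebra (one direction of the
characterization, as a lemma). [folklore] -/
theorem mk_mem_of_isWeightedHomogeneous_zero {k : Type} [Field k] {n : ℕ} {M : Type} [AddCommMonoid M]
    {W : Fin n → M} {g : MvPolynomial (Fin n) k} {A : Subalgebra k (MvPolynomial (Fin n) k ⧸ Ideal.span {g})}
    (hA : ∀ b : MvPolynomial (Fin n) k ⧸ Ideal.span {g}, b ∈ A ↔ ∃ U : MvPolynomial (Fin n) k,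
      MvPolynomial.IsWeightedHomogeneous W U 0 ∧ Ideal.Quotient.mk (Ideal.span {g}) U = b)
    {U : MvPolynomial (Fin n) k} (hU : MvPolynomial.IsWeightedHomogeneous W U 0) :
    Ideal.Quotient.mk (Ideal.span {g}) U ∈ A :=
  (hA _).mpr ⟨U, hU, rfl⟩

/-- **`x̄_j ^ e` has weight `0̄`** for weights with values in `ℤ/e`: `e • W j = 0`, so the class of
`X_j ^ e` lies in the weight-`0̄` subalgebra of `k[X]/(g)`. [folklore] -/
theorem mk_X_pow_mem {k : Type} [Field k] {n : ℕ} (e : ℕ) {W : Fin n → ZMod e} {g : MvPolynomial (Fin n) k}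
    {A : Subalgebra k (MvPolynomial (Fin n) k ⧸ Ideal.span {g})}
    (hA : ∀ b : MvPolynomial (Fin n) k ⧸ Ideal.span {g}, b ∈ A ↔ ∃ U : MvPolynomial (Fin n) k,
      MvPolynomial.IsWeightedHomogeneous W U 0 ∧ Ideal.Quotient.mk (Ideal.span {g}) U = b)
    (j : Fin n) : Ideal.Quotient.mk (Ideal.span {g}) (MvPolynomial.X j) ^ e ∈ A := by
  rw [← map_pow]
  refine mk_mem_of_isWeightedHomogeneous_zero hA ?_
  have h := (isWeightedHomogeneous_X k W j).pow e
  rwa [nsmul_eq_mul, ZMod.natCast_self, zero_mul] at h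

/-- The classes `x̄_j` generate `k[X]/(g)` as a `k`-algebra. [folklore] -/
theorem adjoin_range_mk_X {k : Type} [Field k] {n : ℕ} (g : MvPolynomial (Fin n) k) :
    Algebra.adjoin k (Set.range fun j : Fin n =>
      Ideal.Quotient.mk (Ideal.span {g}) (MvPolynomial.X j : MvPolynomial (Fin n) k)) = ⊤ := by
  have hr : (Set.range fun j : Fin n =>
      Ideal.Quotient.mk (Ideal.span {g}) (MvPolynomial.X j : MvPolynomial (Fin n) k)) =
      (Ideal.Quotient.mkₐ k (Ideal.span {g})) '' Set.range (MvPolynomial.X : Fin n → MvPolynomial (Fin n) k) := by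
    rw [← Set.range_comp]
    rfl
  rw [hr, ← AlgHom.map_adjoin, MvPolynomial.adjoin_range_X, Algebra.map_top, AlgHom.range_eq_top]
  exact Ideal.Quotient.mkₐ_surjective k (Ideal.span {g})

/-! ## The descent -/

/-- **WEIGHT-ZERO DESCENT OF THE CLAUSE.** Let `k` be a field of characteristic `p`, `e > 0`,
`W : Fin n → ℤ/e` weights, `0 ≠ g ∈ k[X₀, …, X_{n-1}]` weighted homogeneous of weight `δ`, `B = k[X]/(g)`
and `A ⊆ B` the weight-`0̄` subalgebra. Let `b ∈ B` and `N` with `b ^ N ∈ A`. If `B_Q` satisfies the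
per-stalk clause of the crux (every system of parameters is weakly regular and generates a Frobenius closed
ideal) at every maximal ideal `Q ∋ b`, then `A_𝔫` satisfies it at every maximal ideal `𝔫 ∋ b ^ N`.
Assembly: retraction `ρ : B → A` (#8 + component rule of #19), `B` integral over `A` (#12 with
`x̄_j ^ e ∈ A`), uniform local dimension `n - 1` of `B` (#10) and of `A` (#11), finite graded descent (#9).
[folklore; Hochster–Roberts-type direct-summand descent, through the imported E4 files] -/
theorem weightZero_clause_descent (p : ℕ) [Fact p.Prime] (k : Type) [Field k] [CharP k p] (n e : ℕ)
    (he : 0 < e) (W : Fin n → ZMod e) (g : MvPolynomial (Fin n) k) (δ : ZMod e)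
    (hg : MvPolynomial.IsWeightedHomogeneous W g δ) (hg0 : g ≠ 0)
    (A : Subalgebra k (MvPolynomial (Fin n) k ⧸ Ideal.span {g}))
    (hA : ∀ b : MvPolynomial (Fin n) k ⧸ Ideal.span {g}, b ∈ A ↔ ∃ U : MvPolynomial (Fin n) k,
      MvPolynomial.IsWeightedHomogeneous W U 0 ∧ Ideal.Quotient.mk (Ideal.span {g}) U = b)
    (b : MvPolynomial (Fin n) k ⧸ Ideal.span {g}) (N : ℕ) (hbN : b ^ N ∈ A)
    (hclB : ∀ (Q : Ideal (MvPolynomial (Fin n) k ⧸ Ideal.span {g})) [Q.IsMaximal], b ∈ Q →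
      ∀ d : ℕ, ringKrullDim (Localization.AtPrime Q) = d → ∀ s : Fin d → Localization.AtPrime Q,
        (Ideal.span (Set.range s)).radical.IsMaximal →
          RingTheory.Sequence.IsWeaklyRegular (Localization.AtPrime Q) (List.ofFn s) ∧
          ∀ y : Localization.AtPrime Q, (∃ e : ℕ, y ^ p ^ e ∈ Ideal.span
            ((fun z : Localization.AtPrime Q => z ^ p ^ e) ''
              (Ideal.span (Set.range s) : Set (Localization.AtPrime Q)))) → y ∈ Ideal.span (Set.range s))
    (𝔫 : Ideal A) [𝔫.IsMaximal] (hb𝔫 : (⟨b ^ N, hbN⟩ : A) ∈ 𝔫) :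
    ∀ d : ℕ, ringKrullDim (Localization.AtPrime 𝔫) = d → ∀ s : Fin d → Localization.AtPrime 𝔫,
      (Ideal.span (Set.range s)).radical.IsMaximal →
        RingTheory.Sequence.IsWeaklyRegular (Localization.AtPrime 𝔫) (List.ofFn s) ∧
        ∀ y : Localization.AtPrime 𝔫, (∃ e : ℕ, y ^ p ^ e ∈ Ideal.span
          ((fun z : Localization.AtPrime 𝔫 => z ^ p ^ e) ''
            (Ideal.span (Set.range s) : Set (Localization.AtPrime 𝔫)))) → y ∈ Ideal.span (Set.range s) := by
  -- `A` has a maximal ideal, so `A`, hence `B = k[X]/(g)`, is nontrivial, of characteristic `p`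
  have hAnt : Nontrivial A := by
    by_contra h
    rw [not_nontrivial_iff_subsingleton] at h
    exact Ideal.IsMaximal.ne_top ‹𝔫.IsMaximal› (Subsingleton.elim _ _)
  haveI hBnt : Nontrivial (MvPolynomial (Fin n) k ⧸ Ideal.span {g}) := by
    obtain ⟨x, y, hxy⟩ := hAnt
    exact ⟨⟨x, y, fun h => hxy (Subtype.ext h)⟩⟩
  haveI : CharP (MvPolynomial (Fin n) k ⧸ Ideal.span {g}) p :=
    charP_of_injective_algebraMap (algebraMap k (MvPolynomial (Fin n) k ⧸ Ideal.span {g})).injective p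
  -- `n = m + 1` (for `n = 0`, `g ≠ 0` is a unit and `B = 0`)
  obtain ⟨m, rfl⟩ : ∃ m, n = m + 1 := by
    cases n with
    | zero =>
      exfalso
      have hu : IsUnit g := by
        rw [MvPolynomial.eq_C_of_isEmpty g]
        refine IsUnit.map MvPolynomial.C (Ne.isUnit fun h0 => hg0 ?_)
        rw [MvPolynomial.eq_C_of_isEmpty g, h0, MvPolynomial.C_0]
      haveI : Subsingleton (MvPolynomial (Fin 0) k ⧸ Ideal.span {g}) :=
        Ideal.Quotient.subsingleton_iff.mpr (Ideal.span_singleton_eq_top.mpr hu)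
      exact false_of_nontrivial_of_subsingleton (MvPolynomial (Fin 0) k ⧸ Ideal.span {g})
    | succ m => exact ⟨m, rfl⟩
  -- the degree-`0̄` retraction `ρ : B → A` (#8, with the component rule of #19)
  obtain ⟨ρ, hρ⟩ := GradeZeroRetractQuotient.stub_gradeZeroRetractQuotient k (m + 1) (ZMod e) W g δ hg
    (fun ψ u δ' μ hψ =>
      WeightedSubstitution.weightedHomogeneousComponent_mul_of_isWeightedHomogeneous hψ u μ) A hA
  -- `B` is integral over `A` (#12: the generators `x̄_j` have `x̄_j ^ e ∈ A`)
  haveI : Algebra.IsIntegral A (MvPolynomial (Fin (m + 1)) k ⧸ Ideal.span {g}) :=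
    SubalgebraIntegralOfPow.stub_subalgebraIntegralOfPow k _ A _ (adjoin_range_mk_X g)
      (by
        rintro _ ⟨j, rfl⟩
        exact ⟨e, he, mk_X_pow_mem e hA j⟩)
  -- uniform local dimension `m` of `B` (#10) and of `A` (#11)
  have hdimB : ∀ (Q : Ideal (MvPolynomial (Fin (m + 1)) k ⧸ Ideal.span {g})) [Q.IsMaximal],
      ringKrullDim (Localization.AtPrime Q) = m := fun Q _ =>
    HypersurfaceLocalDim.stub_hypersurfaceLocalDim k m g hg0 Q
  have hdimA : ∀ (𝔫' : Ideal A) [𝔫'.IsMaximal], ringKrullDim (Localization.AtPrime 𝔫') = m :=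
    IntegralSubalgebraLocalDim.stub_integralSubalgebraLocalDim k _ A m hdimB
  -- finite graded descent (#9)
  exact FiniteGradedDescent.stub_finiteGradedDescent p k _ A ρ hρ b N m hbN hdimB hdimA hclB 𝔫 hb𝔫

end Summit.ResolutionOfSingularities.ResolutionOfSingularities.Theorems.FInjectiveMacaulayfication.WeightZeroClauseDescent

end
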